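import Literature.NumberTheory.Automorphic.ArchGardingLieBracket
import Literature.NumberTheory.Automorphic.ArchGardingOneParamDeriv
import Literature.NumberTheory.Automorphic.ArchRankinSelbergOfTorusKirillov
import Mathlib.Analysis.InnerProductSpace.Calculus
import HarnessLib

/-!
# Calculus of the infinitesimal action on Gårding vectors: linearity in the direction, `Ad(g)`-covariance, skew-symmetry

Topic `NumberTheory/Automorphic`; namespace `Literature.NumberTheory.Automorphic`. Theorems only (no
definition, no named fact), continuing `ArchGardingWhittaker` / `ArchGardingLieBracket` (the Gårding
space `archGardingSpace hcpt τ` of a strongly continuous representation `τ` of `G_∞ = GL_n(K_∞)` on a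
Banach space, the derivatives `archDerivE hcpt τ X v = τ(X) v = d/dt τ(exp tX) v|₀`, the bracket
relation). Three groups of identities, all for Gårding vectors `v` (Getz–Hahn (2024), §4.2; Knapp
(1986), Prop. 3.9: `X ↦ dπ(X)` is a real-linear Lie algebra representation on the smooth vectors,
`π(g) dπ(X) π(g)⁻¹ = dπ(Ad(g) X)`, and `dπ(X)` is skew-Hermitian for unitary `π`):

* **linearity in the direction** — `τ(X + Y) v = τ(X) v + τ(Y) v`, `τ(r X) v = r τ(X) v` (`r ∈ ℝ`),
  `τ(0) v = 0`, `τ(-X) v = -τ(X) v`, finite sums (`archDerivE_add_dir`, `archDerivE_smul_dir`,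
  `archDerivE_zero_dir`, `archDerivE_neg_dir`, `archDerivE_sub_dir`, `archDerivE_sum_dir`), from the
  corresponding identities for the left-invariant derivatives `L_X α` of test functions
  (`IsArchTestFunction.archLeftDeriv_add_dir`, `…_smul_dir`; through `archLeftDeriv_eq_fderiv`,
  `(L_X α)(z) = Dα̃(z)(-X z)`, which is linear in `X`);
* **`Ad(g)`-covariance** — `τ(g) τ(X) v = τ(g X g⁻¹) τ(g) v` (`apply_toArch_archDerivE`; both sides
  are the derivative at `t = 0` of `τ(g exp(tX)) v = τ(exp(t gXg⁻¹) g) v`) and its word version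
  `apply_toArch_archWordDerivE`;
* **skew-symmetry for unitary `τ`** — `⟪τ(X) v, w⟫ + ⟪v, τ(X) w⟫ = 0` for Gårding `v, w`
  (`inner_archDerivE_add_inner_archDerivE_eq_zero`: differentiate the constant
  `t ↦ ⟪τ(exp tX) v, τ(exp tX) w⟫ = ⟪v, w⟫`), with the consequences
  `⟪τ(X) v, w⟫ = -⟪v, τ(X) w⟫` and `⟪τ(X) τ(Y) v, w⟫ = ⟪v, τ(Y) τ(X) w⟫`.

These are the elementary inputs of the infinitesimal-character (Segal) argument for the place
Casimir operators and of Jacquet–Shalika's automatic-continuity argument (Jacquet–Shalika (1981),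
Prop. (3.8)) on the route to the named fact
`Literature.NumberTheory.Automorphic.JacquetShalika1981_archKirillovNorm_le`.

## References

* J. R. Getz, H. Hahn, *An Introduction to Automorphic Representations*, GTM 300 (2024), §4.2,
  Def. 4.1, Lemma 4.2.1, Prop. 4.2.3 [GetzHahn2024].
* A. W. Knapp, *Representation Theory of Semisimple Groups*, Princeton (1986), Ch. III §3,
  Prop. 3.9 [Knapp1986].
* H. Jacquet, J. A. Shalika, *On Euler products and the classification of automorphic
  representations I*, Amer. J. Math. 103 (1981), §3, Prop. (3.8) [JacquetShalikaAJM1981].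
-/

noncomputable section

open MeasureTheory Measure NumberField NumberField.mixedEmbedding IsDedekindDomain Set Filter
open scoped MatrixGroups ENNReal NNReal Classical Topology InnerProductSpace

namespace Literature.NumberTheory.Automorphic

variable {n : ℕ} {K : Type} [Field K] [NumberField K]

attribute [local instance] glInfBorel borelSpace_glInf locallyCompactSpace_glInf secondCountableTopology_glInf

-- as in `ArchGardingWhittaker`
set_option backward.isDefEq.respectTransparency false

/-! ### 1. Linearity of `L_X α` in the direction `X` -/

section TestFunctions

/-- **`L_{X+Y} α = L_X α + L_Y α`** for a test function `α`: through `archLeftDeriv_eq_fderiv`,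
`(L_X α)(z) = Dα̃(z)(-Xz)` is additive in `X`. [folklore] -/
theorem IsArchTestFunction.archLeftDeriv_add_dir {α : GL (Fin n) (mixedSpace K) → ℂ}
    (hα : IsArchTestFunction n K α) (X Y : Matrix (Fin n) (Fin n) (mixedSpace K)) :
    Automorphic.archLeftDeriv (X + Y) α = Automorphic.archLeftDeriv X α + Automorphic.archLeftDeriv Y α := by
  funext z
  rw [Pi.add_apply, hα.archLeftDeriv_eq_fderiv (X + Y) z, hα.archLeftDeriv_eq_fderiv X z,
    hα.archLeftDeriv_eq_fderiv Y z, ← map_add]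
  congr 1
  rw [neg_add, add_mul]

/-- **`L_{rX} α = r L_X α`** (`r ∈ ℝ`) for a test function `α`. [folklore] -/
theorem IsArchTestFunction.archLeftDeriv_smul_dir {α : GL (Fin n) (mixedSpace K) → ℂ}
    (hα : IsArchTestFunction n K α) (r : ℝ) (X : Matrix (Fin n) (Fin n) (mixedSpace K)) :
    Automorphic.archLeftDeriv (r • X) α = (r : ℂ) • Automorphic.archLeftDeriv X α := by
  funext z
  rw [Pi.smul_apply, hα.archLeftDeriv_eq_fderiv (r • X) z, hα.archLeftDeriv_eq_fderiv X z, smul_eq_mul,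
    ← Complex.real_smul, ← ContinuousLinearMap.map_smul]
  congr 1
  rw [← smul_neg, smul_mul_assoc]

/-- `L_0 α = 0` for a test function `α`. [folklore] -/
theorem IsArchTestFunction.archLeftDeriv_zero_dir {α : GL (Fin n) (mixedSpace K) → ℂ}
    (hα : IsArchTestFunction n K α) :
    Automorphic.archLeftDeriv (0 : Matrix (Fin n) (Fin n) (mixedSpace K)) α = 0 := by
  have h := hα.archLeftDeriv_smul_dir 0 0
  rwa [zero_smul, Complex.ofReal_zero, zero_smul] at h

end TestFunctions

/-! ### 2. Linearity of `τ(X) v` in the direction `X` on Gårding vectors -/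

section Garding

variable {hcpt : isCompact_glFiniteIntegralLevel n K}
  {E : Type*} [NormedAddCommGroup E] [NormedSpace ℂ E] [CompleteSpace E]
  {τ : ContRepresentation ℂ (AutomorphyDatum.gl n K hcpt).arch.carrier E}

/-- **`τ(X + Y) v = τ(X) v + τ(Y) v`** for a Gårding vector `v` (Knapp (1986), Prop. 3.9: `dπ` is
real linear on smooth vectors). Write `v = Σ τ(αᵢ) eᵢ`; both sides are `Σ τ(L_X αᵢ + L_Y αᵢ) eᵢ`.
[cite: Knapp1986, Ch. III §3, Prop. 3.9] -/
theorem archDerivE_add_dir (hτ : τ.IsStronglyContinuous) {v : E} (hv : v ∈ archGardingSpace hcpt τ)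
    (X Y : Matrix (Fin n) (Fin n) (mixedSpace K)) :
    archDerivE hcpt τ (X + Y) v = archDerivE hcpt τ X v + archDerivE hcpt τ Y v := by
  obtain ⟨m, α, e, hα, rfl⟩ := exists_sum_eq_of_mem_archGardingSpace hv
  rw [archDerivE_sum_archSmoothing hα hτ e (X + Y), archDerivE_sum_archSmoothing hα hτ e X,
    archDerivE_sum_archSmoothing hα hτ e Y, ← Finset.sum_add_distrib]
  refine Finset.sum_congr rfl fun i _ => ?_
  have hX := (hα i).archLeftDeriv X
  have hY := (hα i).archLeftDeriv Y
  rw [(hα i).archLeftDeriv_add_dir X Y,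
    archSmoothing_add_weight hcpt τ hX.continuous hX.hasCompactSupport hY.continuous hY.hasCompactSupport hτ]

/-- **`τ(r X) v = r τ(X) v`** (`r ∈ ℝ`) for a Gårding vector `v`. [cite: Knapp1986, Ch. III §3, Prop. 3.9] -/
theorem archDerivE_smul_dir (hτ : τ.IsStronglyContinuous) {v : E} (hv : v ∈ archGardingSpace hcpt τ)
    (r : ℝ) (X : Matrix (Fin n) (Fin n) (mixedSpace K)) :
    archDerivE hcpt τ (r • X) v = (r : ℂ) • archDerivE hcpt τ X v := by
  obtain ⟨m, α, e, hα, rfl⟩ := exists_sum_eq_of_mem_archGardingSpace hv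
  rw [archDerivE_sum_archSmoothing hα hτ e (r • X), archDerivE_sum_archSmoothing hα hτ e X, Finset.smul_sum]
  refine Finset.sum_congr rfl fun i _ => ?_
  rw [(hα i).archLeftDeriv_smul_dir r X, archSmoothing_smul_weight]

omit [CompleteSpace E] in
/-- `τ(0) v = 0` for every vector `v` (the orbit `t ↦ τ(exp 0) v = v` is constant). [folklore] -/
theorem archDerivE_zero_dir (v : E) :
    archDerivE hcpt τ (0 : Matrix (Fin n) (Fin n) (mixedSpace K)) v = 0 := by
  unfold archDerivE
  have hfun : (fun t : ℝ => τ (toArch hcpt (expGL (t • (0 : Matrix (Fin n) (Fin n) (mixedSpace K))))) v) =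
      fun _ => v := by
    funext t
    rw [smul_zero, expGL_zero]
    change τ 1 v = v
    rw [map_one]
    rfl
  rw [hfun, deriv_const]

/-- `τ(-X) v = -τ(X) v` for a Gårding vector `v`. [folklore] -/
theorem archDerivE_neg_dir (hτ : τ.IsStronglyContinuous) {v : E} (hv : v ∈ archGardingSpace hcpt τ)
    (X : Matrix (Fin n) (Fin n) (mixedSpace K)) :
    archDerivE hcpt τ (-X) v = -archDerivE hcpt τ X v := by
  have h := archDerivE_smul_dir hτ hv (-1) X
  rwa [neg_one_smul, Complex.ofReal_neg, Complex.ofReal_one, neg_one_smul] at h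

/-- `τ(X - Y) v = τ(X) v - τ(Y) v` for a Gårding vector `v`. [folklore] -/
theorem archDerivE_sub_dir (hτ : τ.IsStronglyContinuous) {v : E} (hv : v ∈ archGardingSpace hcpt τ)
    (X Y : Matrix (Fin n) (Fin n) (mixedSpace K)) :
    archDerivE hcpt τ (X - Y) v = archDerivE hcpt τ X v - archDerivE hcpt τ Y v := by
  rw [sub_eq_add_neg, archDerivE_add_dir hτ hv, archDerivE_neg_dir hτ hv, ← sub_eq_add_neg]

/-- `τ(Σ_i X_i) v = Σ_i τ(X_i) v` for a Gårding vector `v`. [folklore] -/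
theorem archDerivE_sum_dir (hτ : τ.IsStronglyContinuous) {v : E} (hv : v ∈ archGardingSpace hcpt τ)
    {ι : Type*} (s : Finset ι) (X : ι → Matrix (Fin n) (Fin n) (mixedSpace K)) :
    archDerivE hcpt τ (∑ i ∈ s, X i) v = ∑ i ∈ s, archDerivE hcpt τ (X i) v := by
  classical
  induction s using Finset.induction_on with
  | empty => rw [Finset.sum_empty, Finset.sum_empty, archDerivE_zero_dir]
  | insert i s hi ih => rw [Finset.sum_insert hi, Finset.sum_insert hi, archDerivE_add_dir hτ hv, ih]

/-- `τ(Σ_i r_i X_i) v = Σ_i r_i τ(X_i) v` (`r_i ∈ ℝ`) for a Gårding vector `v`: the form in which a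
direction is expanded in a real basis of `𝔤𝔩_n(K_∞)`. [folklore] -/
theorem archDerivE_sum_smul_dir (hτ : τ.IsStronglyContinuous) {v : E} (hv : v ∈ archGardingSpace hcpt τ)
    {ι : Type*} (s : Finset ι) (r : ι → ℝ) (X : ι → Matrix (Fin n) (Fin n) (mixedSpace K)) :
    archDerivE hcpt τ (∑ i ∈ s, r i • X i) v = ∑ i ∈ s, (r i : ℂ) • archDerivE hcpt τ (X i) v := by
  rw [archDerivE_sum_dir hτ hv]
  exact Finset.sum_congr rfl fun i _ => archDerivE_smul_dir hτ hv (r i) (X i)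

/-! ### 3. `Ad(g)`-covariance: `τ(g) τ(X) v = τ(gXg⁻¹) τ(g) v` -/

/-- **`Ad(g)`-covariance of the infinitesimal action**: `τ(g) τ(X) v = τ(g X g⁻¹) (τ(g) v)` for a
Gårding vector `v` (Knapp (1986), Prop. 3.9 / Getz–Hahn (2024), §4.2: both sides are the derivative at
`t = 0` of `τ(g exp(tX)) v = τ(exp(t · gXg⁻¹) g) v`). [cite: Knapp1986, Ch. III §3, Prop. 3.9] -/
theorem apply_toArch_archDerivE (hτ : τ.IsStronglyContinuous) {v : E} (hv : v ∈ archGardingSpace hcpt τ)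
    (g : GL (Fin n) (mixedSpace K)) (X : Matrix (Fin n) (Fin n) (mixedSpace K)) :
    τ (toArch hcpt g) (archDerivE hcpt τ X v) =
      archDerivE hcpt τ ((g : Matrix (Fin n) (Fin n) (mixedSpace K)) * X *
        ((g⁻¹ : GL (Fin n) (mixedSpace K)) : Matrix (Fin n) (Fin n) (mixedSpace K))) (τ (toArch hcpt g) v) := by
  set Y : Matrix (Fin n) (Fin n) (mixedSpace K) := (g : Matrix (Fin n) (Fin n) (mixedSpace K)) * X *
    ((g⁻¹ : GL (Fin n) (mixedSpace K)) : Matrix (Fin n) (Fin n) (mixedSpace K)) with hY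
  have h1 : HasDerivAt (fun t : ℝ => τ (toArch hcpt (expGL (t • Y))) (τ (toArch hcpt g) v))
      (archDerivE hcpt τ Y (τ (toArch hcpt g) v)) 0 :=
    hasDerivAt_apply_expGL_of_mem_archGardingSpace hτ (apply_mem_archGardingSpace hτ _ hv) Y
  have h2 : HasDerivAt (fun t : ℝ => τ (toArch hcpt g) (τ (toArch hcpt (expGL (t • X))) v))
      (τ (toArch hcpt g) (archDerivE hcpt τ X v)) 0 :=
    ((τ (toArch hcpt g)).restrictScalars ℝ).hasFDerivAt.comp_hasDerivAt (0 : ℝ)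
      (hasDerivAt_apply_expGL_of_mem_archGardingSpace hτ hv X)
  have hfun : (fun t : ℝ => τ (toArch hcpt g) (τ (toArch hcpt (expGL (t • X))) v)) =
      fun t : ℝ => τ (toArch hcpt (expGL (t • Y))) (τ (toArch hcpt g) v) := by
    funext t
    rw [← mul_apply_eq_comp, ← map_mul, ← mul_apply_eq_comp, ← map_mul]
    congr 2
    refine Subtype.ext ?_
    change g * expGL (t • X) = expGL (t • Y) * g
    rw [hY, expGL_smul_conj, inv_mul_cancel_right]
  rw [hfun] at h2
  exact h2.unique h1

/-- Word version of `Ad(g)`-covariance: `τ(g) τ(w) v = τ(Ad(g) w) τ(g) v` with `Ad(g)` applied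
letterwise. [cite: Knapp1986, Ch. III §3, Prop. 3.9] -/
theorem apply_toArch_archWordDerivE (hτ : τ.IsStronglyContinuous) (g : GL (Fin n) (mixedSpace K)) {v : E}
    (hv : v ∈ archGardingSpace hcpt τ) :
    ∀ w : List (Matrix (Fin n) (Fin n) (mixedSpace K)),
      τ (toArch hcpt g) (archWordDerivE hcpt τ w v) =
        archWordDerivE hcpt τ (w.map fun X => (g : Matrix (Fin n) (Fin n) (mixedSpace K)) * X *
          ((g⁻¹ : GL (Fin n) (mixedSpace K)) : Matrix (Fin n) (Fin n) (mixedSpace K))) (τ (toArch hcpt g) v)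
  | [] => rfl
  | X :: w => by
    rw [List.map_cons, archWordDerivE_cons, archWordDerivE_cons,
      apply_toArch_archDerivE hτ (archWordDerivE_mem_archGardingSpace hτ w hv) g X,
      apply_toArch_archWordDerivE hτ g hv w]

end Garding

/-! ### 4. Skew-symmetry of `τ(X)` for unitary `τ` -/

section Words

variable {hcpt : isCompact_glFiniteIntegralLevel n K}
  {E : Type*} [NormedAddCommGroup E] [NormedSpace ℂ E]
  {τ : ContRepresentation ℂ (AutomorphyDatum.gl n K hcpt).arch.carrier E}

/-- `τ(w ++ w') v = τ(w) (τ(w') v)`. [folklore] -/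
theorem archWordDerivE_append (w' : List (Matrix (Fin n) (Fin n) (mixedSpace K))) (v : E) :
    ∀ w : List (Matrix (Fin n) (Fin n) (mixedSpace K)),
      archWordDerivE hcpt τ (w ++ w') v = archWordDerivE hcpt τ w (archWordDerivE hcpt τ w' v)
  | [] => rfl
  | X :: w => by rw [List.cons_append, archWordDerivE_cons, archWordDerivE_cons, archWordDerivE_append w' v w]

end Words


section Unitary

variable {hcpt : isCompact_glFiniteIntegralLevel n K}
  {E : Type*} [NormedAddCommGroup E] [InnerProductSpace ℂ E] [CompleteSpace E]
  {τ : ContRepresentation ℂ (AutomorphyDatum.gl n K hcpt).arch.carrier E}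

/-- **`τ(X)` is skew-symmetric on Gårding vectors for unitary `τ`**:
`⟪τ(X) v, w⟫ + ⟪v, τ(X) w⟫ = 0` — the derivative at `t = 0` of the constant function
`t ↦ ⟪τ(exp tX) v, τ(exp tX) w⟫ = ⟪v, w⟫` (Knapp (1986), Prop. 3.9: `dπ(X)` is skew-Hermitian).
[cite: Knapp1986, Ch. III §3, Prop. 3.9] -/
theorem inner_archDerivE_add_inner_archDerivE_eq_zero (hτ : τ.IsStronglyContinuous) (hτu : τ.IsUnitary)
    {v w : E} (hv : v ∈ archGardingSpace hcpt τ) (hw : w ∈ archGardingSpace hcpt τ)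
    (X : Matrix (Fin n) (Fin n) (mixedSpace K)) :
    ⟪archDerivE hcpt τ X v, w⟫_ℂ + ⟪v, archDerivE hcpt τ X w⟫_ℂ = 0 := by
  have h1 := hasDerivAt_apply_expGL_of_mem_archGardingSpace hτ hv X
  have h2 := hasDerivAt_apply_expGL_of_mem_archGardingSpace hτ hw X
  have h := h1.inner ℂ h2
  have hconst : (fun t : ℝ => ⟪τ (toArch hcpt (expGL (t • X))) v, τ (toArch hcpt (expGL (t • X))) w⟫_ℂ) =
      fun _ => ⟪v, w⟫_ℂ := by
    funext t
    exact hτu.inner_map_map _ v w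
  rw [hconst] at h
  have h0 := h.unique (hasDerivAt_const (0 : ℝ) ⟪v, w⟫_ℂ)
  simp only [zero_smul, expGL_zero] at h0
  have e1 : τ (toArch hcpt (1 : GL (Fin n) (mixedSpace K))) v = v := by
    change τ 1 v = v; rw [map_one]; rfl
  have e2 : τ (toArch hcpt (1 : GL (Fin n) (mixedSpace K))) w = w := by
    change τ 1 w = w; rw [map_one]; rfl
  rw [e1, e2] at h0
  rw [add_comm]
  exact h0

/-- `⟪τ(X) v, w⟫ = -⟪v, τ(X) w⟫` for Gårding `v, w` and unitary `τ`. [cite: Knapp1986, Ch. III §3, Prop. 3.9] -/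
theorem inner_archDerivE_left (hτ : τ.IsStronglyContinuous) (hτu : τ.IsUnitary)
    {v w : E} (hv : v ∈ archGardingSpace hcpt τ) (hw : w ∈ archGardingSpace hcpt τ)
    (X : Matrix (Fin n) (Fin n) (mixedSpace K)) :
    ⟪archDerivE hcpt τ X v, w⟫_ℂ = -⟪v, archDerivE hcpt τ X w⟫_ℂ :=
  eq_neg_of_add_eq_zero_left (inner_archDerivE_add_inner_archDerivE_eq_zero hτ hτu hv hw X)

/-- `⟪τ(X) τ(Y) v, w⟫ = ⟪v, τ(Y) τ(X) w⟫` for Gårding `v, w` and unitary `τ` (two applications of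
skew-symmetry): the formal adjoint of a two-letter word is the reversed word. [folklore] -/
theorem inner_archDerivE_archDerivE_left (hτ : τ.IsStronglyContinuous) (hτu : τ.IsUnitary)
    {v w : E} (hv : v ∈ archGardingSpace hcpt τ) (hw : w ∈ archGardingSpace hcpt τ)
    (X Y : Matrix (Fin n) (Fin n) (mixedSpace K)) :
    ⟪archDerivE hcpt τ X (archDerivE hcpt τ Y v), w⟫_ℂ = ⟪v, archDerivE hcpt τ Y (archDerivE hcpt τ X w)⟫_ℂ := by
  rw [inner_archDerivE_left hτ hτu (archDerivE_mem_archGardingSpace hτ Y hv) hw X,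
    inner_archDerivE_left hτ hτu hv (archDerivE_mem_archGardingSpace hτ X hw) Y, neg_neg]

/-- Word version: `⟪τ(w) v, u⟫ = (-1)^{|w|} ⟪v, τ(w.reverse) u⟫` for Gårding `v, u` and unitary `τ`.
[folklore] -/
theorem inner_archWordDerivE_left (hτ : τ.IsStronglyContinuous) (hτu : τ.IsUnitary) :
    ∀ (w : List (Matrix (Fin n) (Fin n) (mixedSpace K))) {v u : E} (_ : v ∈ archGardingSpace hcpt τ)
      (_ : u ∈ archGardingSpace hcpt τ),
      ⟪archWordDerivE hcpt τ w v, u⟫_ℂ = (-1 : ℂ) ^ w.length * ⟪v, archWordDerivE hcpt τ w.reverse u⟫_ℂ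
  | [], v, u, _, _ => by simp
  | X :: w, v, u, hv, hu => by
    rw [archWordDerivE_cons, inner_archDerivE_left hτ hτu (archWordDerivE_mem_archGardingSpace hτ w hv) hu X,
      inner_archWordDerivE_left hτ hτu w hv (archDerivE_mem_archGardingSpace hτ X hu), List.reverse_cons,
      archWordDerivE_append [X] u w.reverse, List.length_cons, pow_succ]
    simp only [archWordDerivE_cons, archWordDerivE_nil]
    ring

end Unitary

end Literature.NumberTheory.Automorphic
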